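import Summits.CriticalPhenomena.PercolationContinuityZ3.Theorems.PercNearOneGluingNoHeavyPcintSiteCertZ3K6Defs
import HarnessLib

/-!
# PCINT lane, kernel check 6/8 of the B2r window certificate (`d = 3`, memory 6, `p = 0.2463`): codes `4860 ≤ n < 5832`

Cell `prim-pcint`, seat `prim-pcint-2`. The Collatz–Wielandt rows `10^5 · rowS ≤ 99995 · 2·10^28 · v` for the windows
with base-6 code in `[4860, 5832)`, by `decide +kernel` (natural-number arithmetic only; two chunks of 486 codes,
hence `maxHeartbeats 0`). Does NOT build on p205010.
-/

namespace Summit.CriticalPhenomena.PercolationContinuityZ3.Theorems.Pcint.Z3S6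

set_option maxHeartbeats 0 in
/-- Rows `4860 ≤ n < 5346` of the certificate hold. [folklore] -/
theorem checkRangeS_6a : checkRangeS 4860 5346 = true := by decide +kernel

set_option maxHeartbeats 0 in
/-- Rows `5346 ≤ n < 5832` of the certificate hold. [folklore] -/
theorem checkRangeS_6b : checkRangeS 5346 5832 = true := by decide +kernel

/-- Rows `4860 ≤ n < 5832` of the certificate hold. [folklore] -/
theorem checkRangeS_6 : checkRangeS 4860 5832 = true := checkRangeS_of_split checkRangeS_6a checkRangeS_6b

end Summit.CriticalPhenomena.PercolationContinuityZ3.Theorems.Pcint.Z3S6
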